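import Literature.NumberTheory.Automorphic.AdelicLatticeSumDecay
import Literature.NumberTheory.Automorphic.MeyerSummationSchwartz
import Literature.NumberTheory.Automorphic.MeyerSummationPoisson
import Literature.NumberTheory.Automorphic.AdelicPoissonScaled
import HarnessLib

/-!
# Lattice tail decay under dilation, and the shifted Riemann-sum remainder on `𝔸_K`

Topic `NumberTheory/Automorphic`; namespace `Literature.NumberTheory.Automorphic`. Proof file
(theorems only: no definition, no named fact, no instance, no `sorry`); generic number field `K`,
`𝔸 = AdeleRing (𝓞 K) K`, `𝕀 = 𝔸ˣ`, `‖b‖ = IdeleClassGroup.ideleNorm K b`, `d = [K:ℚ]`, dual points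
spelled `algebraMap K 𝔸 ξ * b` (rational factor first, as in ★ `AdelicPoissonScaled`).

The scalar (`n = 1`) dictionary of the tree's decay of lattice sums at idelic scale
(★ `AdelicLatticeSumDecay.exists_tsum_enorm_smul_ratVec_le_rpow`, Gelbart (1975) (9.45)–(9.46):
`Σ_{v ∈ Kⁿ ∖ 0} ‖Φ(y • v)‖ ≤ B ‖y‖^{-θ/[K:ℚ]}` for factorizable Schwartz–Bruhat `Φ` and every
idele `y`), extended by linearity to the Bruhat–Schwartz space `𝒮(𝔸_K) = Meyer.schwartzBruhatAdele K`
and to every function it majorises, followed by the `ξ = 0` split of Poisson summation for a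
dilated and translated test function (★ `AdelicPoissonScaled.tsum_comp_mul_sub_eq`, Tate's Lemma
4.2.4 / Gelbart's Lemma 9.13):

* §1 `exists_tsum_enorm_smul_ratVec_le_rpow_of_mem_piSchwartzBruhat` — the vector bound for every
  `Φ ∈ 𝒮(𝔸_Kⁿ) = piSchwartzBruhat K (Fin n)` (span induction);
* §2 **(P2) LATTICE TAIL DECAY UNDER DILATION** `exists_tsum_units_enorm_le_rpow` /
  `exists_summable_tsum_units_norm_le_rpow` / `exists_summable_tsum_units_norm_le_rpow_neg`:
  for `Ψ ∈ 𝒮(𝔸_K)` and `θ > d` there is `C` with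
  `Σ_{ξ ∈ Kˣ} ‖φ(ξ b)‖ ≤ C ‖b‖^{-θ/d}` for EVERY idele `b` and EVERY `φ` with `‖φ‖ ≤ ‖Ψ‖`
  pointwise (the constant is fixed before `φ`: one Bruhat–Schwartz majorant serves a whole family);
  in particular `≤ C_N ‖b‖^{-N}` on `‖b‖ ≥ 1` for every real `N` — the theta TAIL of a
  Bruhat–Schwartz function decays faster than any power under dilation
  (Weil's / Tate's theta estimate; Gelbart (9.46));
* §3 **(P3) SHIFTED RIEMANN-SUM REMAINDER** `norm_tsum_comp_mul_sub_sub_le`: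
  `‖Σ_{ν ∈ K} φ(λ(ν − y)) − μ(D)⁻¹ ‖λ‖⁻¹ ∫ φ dμ‖ ≤ μ(D)⁻¹ ‖λ‖⁻¹ Σ_{ξ ∈ Kˣ} ‖φ̂(ξ λ⁻¹)‖`
  for `φ` continuous of compact support (the `ξ = 0` term of Poisson summation is the Riemann
  integral `μ(D)⁻¹ ‖λ‖⁻¹ φ̂(0)`), and `exists_norm_tsum_comp_mul_sub_sub_le_rpow`: if
  `‖φ̂‖ ≤ ‖Ψ‖` pointwise for a `Ψ ∈ 𝒮(𝔸_K)`, the remainder is `≤ C μ(D)⁻¹ ‖λ‖^{θ/d − 1}`,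
  uniformly in the shift `y` and in `φ` (Gelbart (1975), Lemma 9.13 and (9.45)–(9.46): in the cusp
  `‖λ‖ → 0` the unipotent lattice sum is its Riemann integral up to a rapidly small error);
  `exists_norm_tsum_mul_add_sub_le_rpow` is the affine form `Σ_{ν ∈ K} φ(λ ν + s)` (sums over `Kˣ`
  convert to sums over `{t : K // t ≠ 0}` by Mathlib's `unitsEquivNeZero.tsum_eq`).

Cell `hodgecm-mathlib`, ENGINE T1 (crux H413 = `stmt-HodgeConjecture-24833`), T1-qs road LAW 5,
core of the analytic lemma «lattice sum vs integral along a line in the cusp» ((P2), (P3) of the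
(b2-β) / (b2-α′) / (L5-iii-c) letters; (P4), (P5) in ★ `AdelicLatticeEscapeBoxCount`). HC_CM is
proved only modulo the printed citations until rung 0 closes; this file is unconditional and
touches no binder.

## References

* S. Gelbart, *Automorphic forms on adele groups*, Ann. of Math. Studies 83 (1975), Lemma 9.13,
  (9.45)–(9.46) [Gelbart1975].
* J. W. S. Cassels, A. Fröhlich (eds.), *Algebraic Number Theory* (1967), Ch. XV Lemma 4.2.4,
  §4.2 [CasselsFrohlichANT1967].
* R. Godement, H. Jacquet, *Zeta functions of simple algebras*, LNM 260 (1972), §11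
  [GodementJacquetLNM260].
-/

set_option autoImplicit false

noncomputable section

open MeasureTheory Measure NumberField IsDedekindDomain Set Filter
open scoped ENNReal NNReal Pointwise Topology

namespace Literature.NumberTheory.Automorphic

variable (K : Type) [Field K] [NumberField K]

/-! ## §1 The vector bound on the whole Schwartz–Bruhat space `𝒮(𝔸_Kⁿ)` -/

section Vector

variable {n : ℕ}

/-- **`Σ_{v ∈ Kⁿ ∖ 0} ‖Φ(y • v)‖ ≤ B ‖y‖^{-θ/[K:ℚ]}` for every `Φ ∈ 𝒮(𝔸_Kⁿ)`** (the `ℂ`-span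
`piSchwartzBruhat K (Fin n)` of the factorizable Schwartz–Bruhat functions) and `θ > n [K:ℚ]`, with
`B < ∞` depending only on `Φ`, `θ`: ★ `exists_tsum_enorm_smul_ratVec_le_rpow` on the generators,
extended by linearity (`‖Φ₁ + Φ₂‖ ≤ ‖Φ₁‖ + ‖Φ₂‖`, `‖c Φ‖ = |c| ‖Φ‖` termwise).
[cite: Gelbart1975, (9.45)–(9.46)] -/
theorem exists_tsum_enorm_smul_ratVec_le_rpow_of_mem_piSchwartzBruhat
    {Φ : (Fin n → AdeleRing (𝓞 K) K) → ℂ} (hΦ : Φ ∈ piSchwartzBruhat K (Fin n)) {θ : ℝ}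
    (hθ : (n : ℝ) * Module.finrank ℚ K < θ) :
    ∃ B : ℝ≥0∞, B ≠ ∞ ∧ ∀ y : (AdeleRing (𝓞 K) K)ˣ,
      ∑' v : ↥{v : Fin n → K | v ≠ 0}, ‖Φ ((y : AdeleRing (𝓞 K) K) • ratVec K v.1)‖ₑ ≤
        B * ENNReal.ofReal ((IdeleClassGroup.ideleNorm K y : ℝ) ^ (-θ / Module.finrank ℚ K)) := by
  induction hΦ using Submodule.span_induction with
  | mem Φ h => exact exists_tsum_enorm_smul_ratVec_le_rpow K h hθ
  | zero =>
    refine ⟨0, ENNReal.zero_ne_top, fun y => ?_⟩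
    simp only [Pi.zero_apply, enorm_zero, tsum_zero, zero_mul, le_refl]
  | add Φ₁ Φ₂ _ _ h₁ h₂ =>
    obtain ⟨B₁, hB₁, h₁⟩ := h₁
    obtain ⟨B₂, hB₂, h₂⟩ := h₂
    refine ⟨B₁ + B₂, ENNReal.add_ne_top.2 ⟨hB₁, hB₂⟩, fun y => ?_⟩
    calc ∑' v : ↥{v : Fin n → K | v ≠ 0},
          ‖(Φ₁ + Φ₂) ((y : AdeleRing (𝓞 K) K) • ratVec K v.1)‖ₑ
        ≤ ∑' v : ↥{v : Fin n → K | v ≠ 0},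
            (‖Φ₁ ((y : AdeleRing (𝓞 K) K) • ratVec K v.1)‖ₑ +
              ‖Φ₂ ((y : AdeleRing (𝓞 K) K) • ratVec K v.1)‖ₑ) :=
          ENNReal.tsum_le_tsum fun v => by
            rw [Pi.add_apply]
            exact enorm_add_le _ _
      _ = (∑' v : ↥{v : Fin n → K | v ≠ 0}, ‖Φ₁ ((y : AdeleRing (𝓞 K) K) • ratVec K v.1)‖ₑ) +
            ∑' v : ↥{v : Fin n → K | v ≠ 0}, ‖Φ₂ ((y : AdeleRing (𝓞 K) K) • ratVec K v.1)‖ₑ :=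
          ENNReal.tsum_add
      _ ≤ B₁ * ENNReal.ofReal ((IdeleClassGroup.ideleNorm K y : ℝ) ^ (-θ / Module.finrank ℚ K)) +
            B₂ * ENNReal.ofReal ((IdeleClassGroup.ideleNorm K y : ℝ) ^ (-θ / Module.finrank ℚ K)) :=
          add_le_add (h₁ y) (h₂ y)
      _ = (B₁ + B₂) *
            ENNReal.ofReal ((IdeleClassGroup.ideleNorm K y : ℝ) ^ (-θ / Module.finrank ℚ K)) :=
          (add_mul _ _ _).symm
  | smul c Φ _ h =>
    obtain ⟨B, hB, h⟩ := h
    refine ⟨‖c‖ₑ * B, ENNReal.mul_ne_top enorm_ne_top hB, fun y => ?_⟩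
    calc ∑' v : ↥{v : Fin n → K | v ≠ 0}, ‖(c • Φ) ((y : AdeleRing (𝓞 K) K) • ratVec K v.1)‖ₑ
        = ∑' v : ↥{v : Fin n → K | v ≠ 0},
            ‖c‖ₑ * ‖Φ ((y : AdeleRing (𝓞 K) K) • ratVec K v.1)‖ₑ :=
          tsum_congr fun v => by rw [Pi.smul_apply, smul_eq_mul, enorm_mul]
      _ = ‖c‖ₑ * ∑' v : ↥{v : Fin n → K | v ≠ 0}, ‖Φ ((y : AdeleRing (𝓞 K) K) • ratVec K v.1)‖ₑ :=
          ENNReal.tsum_mul_left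
      _ ≤ ‖c‖ₑ * (B *
            ENNReal.ofReal ((IdeleClassGroup.ideleNorm K y : ℝ) ^ (-θ / Module.finrank ℚ K))) := by
          gcongr
          exact h y
      _ = ‖c‖ₑ * B *
            ENNReal.ofReal ((IdeleClassGroup.ideleNorm K y : ℝ) ^ (-θ / Module.finrank ℚ K)) :=
          (mul_assoc _ _ _).symm

end Vector

omit [NumberField K] in
/-- Summability over `K` from summability over `Kˣ` (only the term `ξ = 0` is missing).
[folklore] -/
private theorem summable_of_summable_units {β : Type*} [AddCommGroup β] [UniformSpace β]
    [IsUniformAddGroup β] [CompleteSpace β] {g : K → β} (hg : Summable fun ξ : Kˣ => g (ξ : K)) :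
    Summable g := by
  classical
  rw [← Finset.summable_compl_iff ({0} : Finset K)]
  set e : Kˣ ≃ {x : K // x ∉ ({0} : Finset K)} :=
    unitsEquivNeZero.trans (Equiv.subtypeEquivRight fun x => by simp) with he
  exact (e.summable_iff (f := fun x : {x : K // x ∉ ({0} : Finset K)} => g x)).1 hg


/-! ## §2 (P2) Lattice tail decay under dilation -/

section TailDecay

/-- **(P2), extended-real form with a majorant.** For `Ψ` in the Bruhat–Schwartz space
`𝒮(𝔸_K) = Meyer.schwartzBruhatAdele K` and `θ > [K:ℚ]` there is `B < ∞` such that for EVERY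
`φ : 𝔸_K → ℂ` with `‖φ‖ ≤ ‖Ψ‖` pointwise and EVERY idele `b`,
`Σ_{ξ ∈ Kˣ} ‖φ(ξ b)‖ ≤ B ‖b‖^{-θ/[K:ℚ]}` (the `n = 1` case of §1 through
`Kˣ ≃ {v : K^{Fin 1} | v ≠ 0}`, and monotonicity). [cite: Gelbart1975, (9.45)–(9.46)] -/
theorem exists_tsum_units_enorm_le_rpow {Ψ : AdeleRing (𝓞 K) K → ℂ}
    (hΨ : Ψ ∈ Meyer.schwartzBruhatAdele K) {θ : ℝ} (hθ : (Module.finrank ℚ K : ℝ) < θ) :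
    ∃ B : ℝ≥0∞, B ≠ ∞ ∧ ∀ φ : AdeleRing (𝓞 K) K → ℂ, (∀ x, ‖φ x‖ ≤ ‖Ψ x‖) →
      ∀ b : (AdeleRing (𝓞 K) K)ˣ,
        ∑' ξ : Kˣ, ‖φ (algebraMap K (AdeleRing (𝓞 K) K) (ξ : K) * (b : AdeleRing (𝓞 K) K))‖ₑ ≤
          B * ENNReal.ofReal ((IdeleClassGroup.ideleNorm K b : ℝ) ^ (-θ / Module.finrank ℚ K)) := by
  have hΦ : (fun v : Fin 1 → AdeleRing (𝓞 K) K => Ψ (v 0)) ∈ piSchwartzBruhat K (Fin 1) :=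
    (Meyer.mem_schwartzBruhatAdele_iff).1 hΨ
  have hθ' : ((1 : ℕ) : ℝ) * Module.finrank ℚ K < θ := by rwa [Nat.cast_one, one_mul]
  obtain ⟨B, hB, h⟩ := exists_tsum_enorm_smul_ratVec_le_rpow_of_mem_piSchwartzBruhat K hΦ hθ'
  obtain ⟨eqv, heqv⟩ := Meyer.exists_equiv_units_ne_zero_vec (K := K)
  refine ⟨B, hB, fun φ hφ b => ?_⟩
  refine le_trans ?_ (h b)
  rw [← eqv.tsum_eq]
  refine ENNReal.tsum_le_tsum fun a => ?_
  rw [← ofReal_norm, ← ofReal_norm]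
  refine ENNReal.ofReal_le_ofReal ((hφ _).trans (le_of_eq ?_))
  rw [heqv a, Pi.smul_apply, smul_eq_mul, ratVec, mul_comm]

/-- **(P2), real form.** For `Ψ ∈ 𝒮(𝔸_K)` and `θ > [K:ℚ]` there is `C ≥ 0` such that for every
`φ` with `‖φ‖ ≤ ‖Ψ‖` pointwise and every idele `b` the family `ξ ↦ ‖φ(ξ b)‖` (`ξ ∈ Kˣ`) is summable
with `Σ_{ξ ∈ Kˣ} ‖φ(ξ b)‖ ≤ C ‖b‖^{-θ/[K:ℚ]}`. [cite: Gelbart1975, (9.45)–(9.46)] -/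
theorem exists_summable_tsum_units_norm_le_rpow {Ψ : AdeleRing (𝓞 K) K → ℂ}
    (hΨ : Ψ ∈ Meyer.schwartzBruhatAdele K) {θ : ℝ} (hθ : (Module.finrank ℚ K : ℝ) < θ) :
    ∃ C : ℝ, 0 ≤ C ∧ ∀ φ : AdeleRing (𝓞 K) K → ℂ, (∀ x, ‖φ x‖ ≤ ‖Ψ x‖) →
      ∀ b : (AdeleRing (𝓞 K) K)ˣ,
        Summable (fun ξ : Kˣ =>
          ‖φ (algebraMap K (AdeleRing (𝓞 K) K) (ξ : K) * (b : AdeleRing (𝓞 K) K))‖) ∧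
        ∑' ξ : Kˣ, ‖φ (algebraMap K (AdeleRing (𝓞 K) K) (ξ : K) * (b : AdeleRing (𝓞 K) K))‖ ≤
          C * (IdeleClassGroup.ideleNorm K b : ℝ) ^ (-θ / Module.finrank ℚ K) := by
  obtain ⟨B, hB, h⟩ := exists_tsum_units_enorm_le_rpow K hΨ hθ
  refine ⟨B.toReal, ENNReal.toReal_nonneg, fun φ hφ b => ?_⟩
  have hp : 0 ≤ (IdeleClassGroup.ideleNorm K b : ℝ) ^ (-θ / Module.finrank ℚ K) :=
    Real.rpow_nonneg (NNReal.coe_nonneg _) _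
  have h1 : ∑' ξ : Kˣ, ENNReal.ofReal
      ‖φ (algebraMap K (AdeleRing (𝓞 K) K) (ξ : K) * (b : AdeleRing (𝓞 K) K))‖ ≤
      B * ENNReal.ofReal ((IdeleClassGroup.ideleNorm K b : ℝ) ^ (-θ / Module.finrank ℚ K)) := by
    simp_rw [ofReal_norm]
    exact h φ hφ b
  obtain ⟨hs, hle⟩ := Meyer.summable_and_tsum_le_of_tsum_ofReal_le (fun _ => norm_nonneg _)
    (ENNReal.mul_ne_top hB ENNReal.ofReal_ne_top) h1
  refine ⟨hs, hle.trans (le_of_eq ?_)⟩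
  rw [ENNReal.toReal_mul, ENNReal.toReal_ofReal hp]

/-- **(P2) LATTICE TAIL DECAY UNDER DILATION, as printed**: for `Ψ ∈ 𝒮(𝔸_K)` and every real `N`
there is `C ≥ 0` such that for every `φ` with `‖φ‖ ≤ ‖Ψ‖` pointwise and every idele `b` with
`1 ≤ ‖b‖`: `Σ_{ξ ∈ Kˣ} ‖φ(ξ b)‖ ≤ C ‖b‖^{-N}` (and the sum converges) — the theta tail of a
Bruhat–Schwartz function decays faster than any power of the dilation (Weil's / Tate's theta
estimate, [Tate1967 §4.2]; Gelbart (1975), (9.46)). [cite: Gelbart1975, (9.45)–(9.46)] -/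
theorem exists_summable_tsum_units_norm_le_rpow_neg {Ψ : AdeleRing (𝓞 K) K → ℂ}
    (hΨ : Ψ ∈ Meyer.schwartzBruhatAdele K) (N : ℝ) :
    ∃ C : ℝ, 0 ≤ C ∧ ∀ φ : AdeleRing (𝓞 K) K → ℂ, (∀ x, ‖φ x‖ ≤ ‖Ψ x‖) →
      ∀ b : (AdeleRing (𝓞 K) K)ˣ, 1 ≤ (IdeleClassGroup.ideleNorm K b : ℝ) →
        Summable (fun ξ : Kˣ =>
          ‖φ (algebraMap K (AdeleRing (𝓞 K) K) (ξ : K) * (b : AdeleRing (𝓞 K) K))‖) ∧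
        ∑' ξ : Kˣ, ‖φ (algebraMap K (AdeleRing (𝓞 K) K) (ξ : K) * (b : AdeleRing (𝓞 K) K))‖ ≤
          C * (IdeleClassGroup.ideleNorm K b : ℝ) ^ (-N) := by
  have hd : (0 : ℝ) < Module.finrank ℚ K := Nat.cast_pos.2 Module.finrank_pos
  -- `θ := max N 2 · d > d`, exponent `-θ/d = -max N 2 ≤ -N`
  set θ : ℝ := max N 2 * Module.finrank ℚ K with hθdef
  have hθ : (Module.finrank ℚ K : ℝ) < θ := by
    rw [hθdef]
    have h2 : (2 : ℝ) ≤ max N 2 := le_max_right _ _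
    nlinarith
  obtain ⟨C, hC, h⟩ := exists_summable_tsum_units_norm_le_rpow K hΨ hθ
  refine ⟨C, hC, fun φ hφ b hb => ?_⟩
  obtain ⟨hs, hle⟩ := h φ hφ b
  refine ⟨hs, hle.trans (mul_le_mul_of_nonneg_left ?_ hC)⟩
  have he : -θ / Module.finrank ℚ K = -max N 2 := by
    rw [hθdef, neg_mul_eq_neg_mul, mul_div_assoc, div_self hd.ne', mul_one]
  rw [he]
  exact Real.rpow_le_rpow_of_exponent_le hb (neg_le_neg (le_max_left _ _))

end TailDecay

/-! ## §3 (P3) The shifted Riemann-sum remainder -/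

section Remainder

variable [MeasurableSpace (AdeleRing (𝓞 K) K)] [BorelSpace (AdeleRing (𝓞 K) K)]
  (μ : Measure (AdeleRing (𝓞 K) K)) [μ.IsAddHaarMeasure]

/-- **(P3) SHIFTED RIEMANN-SUM REMAINDER.** For `φ : 𝔸_K → ℂ` continuous of compact support, an
idele `λ`, an adele `y`, and `Σ_{ξ ∈ K} ‖φ̂(ξ λ⁻¹)‖ < ∞` (`φ̂(η) = ∫ φ(v) ψ(η v) dμ`):
`‖Σ_{ν ∈ K} φ(λ(ν − y)) − μ(D)⁻¹ ‖λ‖⁻¹ ∫ φ dμ‖ ≤ μ(D)⁻¹ ‖λ‖⁻¹ Σ_{ξ ∈ Kˣ} ‖φ̂(ξ λ⁻¹)‖`,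
uniformly in the shift `y` — the `ξ = 0` term of Poisson summation
(★ `tsum_comp_mul_sub_eq`) is the Riemann integral `μ(D)⁻¹ ‖λ‖⁻¹ φ̂(0)`, `|ψ(ξ y)| = 1` on the
rest. [cite: Gelbart1975, Lemma 9.13] -/
theorem norm_tsum_comp_mul_sub_sub_le {φ : AdeleRing (𝓞 K) K → ℂ} (hφ : Continuous φ)
    (hφs : HasCompactSupport φ) (lam : (AdeleRing (𝓞 K) K)ˣ) (y : AdeleRing (𝓞 K) K)
    (hsum : Summable fun ξ : K =>
      ‖∫ v, φ v * (adeleAddChar K (algebraMap K (AdeleRing (𝓞 K) K) ξ *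
        ((lam⁻¹ : (AdeleRing (𝓞 K) K)ˣ) : AdeleRing (𝓞 K) K) * v) : ℂ) ∂μ‖) :
    ‖∑' ν : K, φ ((lam : AdeleRing (𝓞 K) K) * (algebraMap K (AdeleRing (𝓞 K) K) ν - y)) -
        (μ (adeleFundamentalDomain K)).toReal⁻¹ * ((IdeleClassGroup.ideleNorm K lam : ℝ)⁻¹ *
          ∫ v, φ v ∂μ)‖ ≤
      (μ (adeleFundamentalDomain K)).toReal⁻¹ * ((IdeleClassGroup.ideleNorm K lam : ℝ≥0) : ℝ)⁻¹ *
        ∑' ξ : Kˣ, ‖∫ v, φ v * (adeleAddChar K (algebraMap K (AdeleRing (𝓞 K) K) (ξ : K) *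
          ((lam⁻¹ : (AdeleRing (𝓞 K) K)ˣ) : AdeleRing (𝓞 K) K) * v) : ℂ) ∂μ‖ := by
  -- the Poisson-side summand
  set F : K → ℂ := fun ξ =>
    (adeleAddChar K (algebraMap K (AdeleRing (𝓞 K) K) ξ * y) : ℂ) *
      ((((IdeleClassGroup.ideleNorm K lam : ℝ≥0) : ℝ)⁻¹ : ℝ) •
        ∫ v, φ v * (adeleAddChar K (algebraMap K (AdeleRing (𝓞 K) K) ξ *
          ((lam⁻¹ : (AdeleRing (𝓞 K) K)ˣ) : AdeleRing (𝓞 K) K) * v) : ℂ) ∂μ) with hF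
  have hnormF : ∀ ξ : K, ‖F ξ‖ = ((IdeleClassGroup.ideleNorm K lam : ℝ≥0) : ℝ)⁻¹ *
      ‖∫ v, φ v * (adeleAddChar K (algebraMap K (AdeleRing (𝓞 K) K) ξ *
        ((lam⁻¹ : (AdeleRing (𝓞 K) K)ˣ) : AdeleRing (𝓞 K) K) * v) : ℂ) ∂μ‖ := by
    intro ξ
    rw [hF]
    dsimp only
    rw [norm_mul, Circle.norm_coe, one_mul, _root_.norm_smul, norm_inv,
      Real.norm_of_nonneg (NNReal.coe_nonneg _)]
  have hsumF : Summable F := by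
    refine Summable.of_norm ?_
    simp_rw [hnormF]
    exact hsum.mul_left _
  -- Poisson summation and the `ξ = 0` split
  rw [tsum_comp_mul_sub_eq K μ hφ hφs lam y hsum, Meyer.tsum_eq_zero_add_tsum_units hsumF]
  have hF0 : F 0 = ((((IdeleClassGroup.ideleNorm K lam : ℝ≥0) : ℝ)⁻¹ : ℝ) : ℂ) * ∫ v, φ v ∂μ := by
    rw [hF]
    dsimp only
    rw [map_zero, zero_mul, AddChar.map_zero_eq_one, Circle.coe_one, one_mul, Complex.real_smul]
    congr 1
    refine integral_congr_ae (Filter.Eventually.of_forall fun v => ?_)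
    dsimp only
    rw [zero_mul, zero_mul, AddChar.map_zero_eq_one, Circle.coe_one, mul_one]
  have hsplit : (μ (adeleFundamentalDomain K)).toReal⁻¹ * (F 0 + ∑' a : Kˣ, F (a : K)) -
      (μ (adeleFundamentalDomain K)).toReal⁻¹ * ((IdeleClassGroup.ideleNorm K lam : ℝ)⁻¹ *
        ∫ v, φ v ∂μ) =
      ((μ (adeleFundamentalDomain K)).toReal⁻¹ : ℂ) * ∑' a : Kˣ, F (a : K) := by
    rw [hF0]
    push_cast
    ring
  rw [hsplit, norm_mul, norm_inv, Complex.norm_real, Real.norm_of_nonneg ENNReal.toReal_nonneg,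
    mul_assoc]
  refine mul_le_mul_of_nonneg_left ?_ (inv_nonneg.2 ENNReal.toReal_nonneg)
  refine (norm_tsum_le_tsum_norm (hsumF.comp_injective Units.val_injective).norm).trans
    (le_of_eq ?_)
  rw [← tsum_mul_left]
  exact tsum_congr fun ξ => hnormF ξ

/-- **(P3) with a Bruhat–Schwartz majorant: the remainder is `O(‖λ‖^{θ/d − 1})`, uniformly in the
shift and in the family.** For `Ψ ∈ 𝒮(𝔸_K)` and `θ > d = [K:ℚ]` there is `C ≥ 0` such that for every
continuous compactly supported `φ : 𝔸_K → ℂ` whose Fourier transform is majorised by `Ψ`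
(`‖∫ φ(v) ψ(η v) dμ‖ ≤ ‖Ψ(η)‖` for all `η`), every idele `λ` and every adele `y`:
`‖Σ_{ν ∈ K} φ(λ(ν − y)) − μ(D)⁻¹ ‖λ‖⁻¹ ∫ φ dμ‖ ≤ μ(D)⁻¹ · C · ‖λ‖^{θ/d − 1}`
(§3 and (P2) at `b = λ⁻¹`; in the cusp `‖λ‖ → 0` this is Gelbart's `C_N e^{2t} e^{-2Nt}`).
[cite: Gelbart1975, Lemma 9.13 and (9.45)–(9.46)] -/
theorem exists_norm_tsum_comp_mul_sub_sub_le_rpow {Ψ : AdeleRing (𝓞 K) K → ℂ}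
    (hΨ : Ψ ∈ Meyer.schwartzBruhatAdele K) {θ : ℝ} (hθ : (Module.finrank ℚ K : ℝ) < θ) :
    ∃ C : ℝ, 0 ≤ C ∧ ∀ (φ : AdeleRing (𝓞 K) K → ℂ) (lam : (AdeleRing (𝓞 K) K)ˣ)
      (y : AdeleRing (𝓞 K) K), Continuous φ → HasCompactSupport φ →
      (∀ η : AdeleRing (𝓞 K) K, ‖∫ v, φ v * (adeleAddChar K (η * v) : ℂ) ∂μ‖ ≤ ‖Ψ η‖) →
        ‖∑' ν : K, φ ((lam : AdeleRing (𝓞 K) K) * (algebraMap K (AdeleRing (𝓞 K) K) ν - y)) -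
            (μ (adeleFundamentalDomain K)).toReal⁻¹ * ((IdeleClassGroup.ideleNorm K lam : ℝ)⁻¹ *
              ∫ v, φ v ∂μ)‖ ≤
          (μ (adeleFundamentalDomain K)).toReal⁻¹ * C *
            (IdeleClassGroup.ideleNorm K lam : ℝ) ^ (θ / Module.finrank ℚ K - 1) := by
  obtain ⟨C, hC, h⟩ := exists_summable_tsum_units_norm_le_rpow K hΨ hθ
  refine ⟨C, hC, fun φ lam y hφ hφs hmaj => ?_⟩
  -- the Fourier transform of `φ`, as a function on `𝔸_K`, is majorised by `Ψ`
  set φhat : AdeleRing (𝓞 K) K → ℂ := fun η => ∫ v, φ v * (adeleAddChar K (η * v) : ℂ) ∂μ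
    with hφhat
  obtain ⟨hs, hle⟩ := h φhat hmaj lam⁻¹
  have hN0 : 0 < (IdeleClassGroup.ideleNorm K lam : ℝ) :=
    NNReal.coe_pos.2 (pos_iff_ne_zero.2 (ideleNorm_ne_zero lam))
  have hinv : (IdeleClassGroup.ideleNorm K lam⁻¹ : ℝ) = (IdeleClassGroup.ideleNorm K lam : ℝ)⁻¹ := by
    rw [map_inv, NNReal.coe_inv]
  -- summability over all of `K` from the summability over `Kˣ`
  have hsumK : Summable fun ξ : K =>
      ‖∫ v, φ v * (adeleAddChar K (algebraMap K (AdeleRing (𝓞 K) K) ξ *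
        ((lam⁻¹ : (AdeleRing (𝓞 K) K)ˣ) : AdeleRing (𝓞 K) K) * v) : ℂ) ∂μ‖ :=
    summable_of_summable_units K hs
  refine (norm_tsum_comp_mul_sub_sub_le K μ hφ hφs lam y hsumK).trans ?_
  have hle' : ∑' ξ : Kˣ, ‖φhat (algebraMap K (AdeleRing (𝓞 K) K) (ξ : K) *
      ((lam⁻¹ : (AdeleRing (𝓞 K) K)ˣ) : AdeleRing (𝓞 K) K))‖ ≤
      C * (IdeleClassGroup.ideleNorm K lam : ℝ) ^ (θ / Module.finrank ℚ K) := by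
    rw [hinv, Real.inv_rpow hN0.le, neg_div, Real.rpow_neg hN0.le, inv_inv] at hle
    exact hle
  have hD : 0 ≤ (μ (adeleFundamentalDomain K)).toReal⁻¹ := inv_nonneg.2 ENNReal.toReal_nonneg
  calc (μ (adeleFundamentalDomain K)).toReal⁻¹ * ((IdeleClassGroup.ideleNorm K lam : ℝ≥0) : ℝ)⁻¹ *
        ∑' ξ : Kˣ, ‖∫ v, φ v * (adeleAddChar K (algebraMap K (AdeleRing (𝓞 K) K) (ξ : K) *
          ((lam⁻¹ : (AdeleRing (𝓞 K) K)ˣ) : AdeleRing (𝓞 K) K) * v) : ℂ) ∂μ‖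
      ≤ (μ (adeleFundamentalDomain K)).toReal⁻¹ * ((IdeleClassGroup.ideleNorm K lam : ℝ≥0) : ℝ)⁻¹ *
          (C * (IdeleClassGroup.ideleNorm K lam : ℝ) ^ (θ / Module.finrank ℚ K)) :=
        mul_le_mul_of_nonneg_left hle' (mul_nonneg hD (inv_nonneg.2 (NNReal.coe_nonneg _)))
    _ = (μ (adeleFundamentalDomain K)).toReal⁻¹ * C *
          (IdeleClassGroup.ideleNorm K lam : ℝ) ^ (θ / Module.finrank ℚ K - 1) := by
        rw [Real.rpow_sub_one hN0.ne']
        ring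


/-- **(P3), affine form `t ↦ λ t + s`** (the shape of the unipotent lattice sums
`Σ_{t ∈ F} h(λ t + s)`): under the hypotheses of `exists_norm_tsum_comp_mul_sub_sub_le_rpow`,
with the same constant, for every idele `λ` and every adele shift `s`,
`‖Σ_{ν ∈ K} φ(λ ν + s) − μ(D)⁻¹ ‖λ‖⁻¹ ∫ φ dμ‖ ≤ μ(D)⁻¹ · C · ‖λ‖^{θ/d − 1}` (take `y = −λ⁻¹ s`).
[cite: Gelbart1975, Lemma 9.13 and (9.45)–(9.46)] -/
theorem exists_norm_tsum_mul_add_sub_le_rpow {Ψ : AdeleRing (𝓞 K) K → ℂ}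
    (hΨ : Ψ ∈ Meyer.schwartzBruhatAdele K) {θ : ℝ} (hθ : (Module.finrank ℚ K : ℝ) < θ) :
    ∃ C : ℝ, 0 ≤ C ∧ ∀ (φ : AdeleRing (𝓞 K) K → ℂ) (lam : (AdeleRing (𝓞 K) K)ˣ)
      (s : AdeleRing (𝓞 K) K), Continuous φ → HasCompactSupport φ →
      (∀ η : AdeleRing (𝓞 K) K, ‖∫ v, φ v * (adeleAddChar K (η * v) : ℂ) ∂μ‖ ≤ ‖Ψ η‖) →
        ‖∑' ν : K, φ ((lam : AdeleRing (𝓞 K) K) * algebraMap K (AdeleRing (𝓞 K) K) ν + s) -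
            (μ (adeleFundamentalDomain K)).toReal⁻¹ * ((IdeleClassGroup.ideleNorm K lam : ℝ)⁻¹ *
              ∫ v, φ v ∂μ)‖ ≤
          (μ (adeleFundamentalDomain K)).toReal⁻¹ * C *
            (IdeleClassGroup.ideleNorm K lam : ℝ) ^ (θ / Module.finrank ℚ K - 1) := by
  obtain ⟨C, hC, h⟩ := exists_norm_tsum_comp_mul_sub_sub_le_rpow K μ hΨ hθ
  refine ⟨C, hC, fun φ lam s hφ hφs hmaj => ?_⟩
  have key : ∀ ν : K, (lam : AdeleRing (𝓞 K) K) * algebraMap K (AdeleRing (𝓞 K) K) ν + s =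
      (lam : AdeleRing (𝓞 K) K) * (algebraMap K (AdeleRing (𝓞 K) K) ν -
        -(((lam⁻¹ : (AdeleRing (𝓞 K) K)ˣ) : AdeleRing (𝓞 K) K) * s)) := by
    intro ν
    rw [sub_neg_eq_add, mul_add, ← mul_assoc, Units.mul_inv, one_mul]
  simp_rw [key]
  exact h φ lam _ hφ hφs hmaj

end Remainder

end Literature.NumberTheory.Automorphic
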